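import Mathlib.Analysis.Calculus.BumpFunction.FiniteDimension
import Mathlib.MeasureTheory.Measure.Lebesgue.VolumeOfBalls
import Literature.Analysis.FluidPDE.DissipatesAtScale
import Summits.NavierStokesRegularity.NavierStokesRegularity.Theorems.SelfMixingDichotomyMixingPayoffWindowRegularity
import Summits.NavierStokesRegularity.NavierStokesRegularity.Theorems.SelfMixingDichotomyMixingPayoffAdvectionDiffusionSchwartz
import Summits.NavierStokesRegularity.NavierStokesRegularity.Theorems.SelfMixingDichotomyMixingPayoffAdmissibleMinPrinciple
import Summits.NavierStokesRegularity.NavierStokesRegularity.Theorems.SelfMixingDichotomyMixingPayoffTypeIFloorAssembly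
import Summits.NavierStokesRegularity.NavierStokesRegularity.Theorems.SelfMixingDichotomyMixingPayoffMassExportCutoff
import Summits.NavierStokesRegularity.NavierStokesRegularity.Theorems.SelfMixingDichotomyMixingPayoffMassExportTools
import HarnessLib

/-!
# Crux `MixingPayoff` (stmt-NavierStokesRegularity-1422), line `birth`: MASS EXPORT —
  `δ`-mixing at scale `r` forces velocity `≳ δ^{-2/3}/r` on the window

Proof file (`--supports stmt-NavierStokesRegularity-1422`) for the registered anchor
`mixingPayoff_massExport`, the rigorous form of the "mass export" constraint on the open heart
`stub_mixingForcesTypeI` ("cofinal `δ`-mixing ⇒ Type-I(K)") of the line: there are ABSOLUTE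
constants `δ₀, c > 0` such that for a standing solution (`0 < T`, `(u, p)` classical on
`[0, T) × ℝ³`, `ν = 1`, `f = 0`, Leray–Hopf from `u 0`, rapidly decaying datum), `0 < r`,
`r² < T`, `0 < δ ≤ δ₀` and `DissipatesAtScale u T x₀ r δ` (the route's MIX: every admissible
scalar launched from a blob in `B(x₀, r)` keeps at most the fraction `δ` of its `L²` norm after
half a diffusive time), the speed `‖u‖` reaches `c δ^{-2/3}/r` somewhere on
`[T − r², T − r²/2] × B̄(x₀, r δ^{-2/3})`. Mixing a scale-`r` blob down to `L²`-fraction `δ`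
in time `r²/2` forces the divergence-free drift to carry scalar MASS out to distance
`∼ r δ^{-2/3}`, hence to be that fast somewhere there.

Argument (all constants absolute; `|B₁|` the volume of the unit ball; `s = δ^{-2/3}`,
`R = r s/16`). Suppose `‖u‖ < c s/r` on the window over `B̄(x₀, r s)`.
1. Launch `θ` from the bump `φ` (`= 1` on `B̄(x₀, r/2)`, `supp φ = B(x₀, r)`, `0 ≤ φ ≤ 1`)
   through W (`stub_windowRegularity`, `stub_advectionDiffusionSchwartz`); `θ ≥ 0`
   (`stub_admissibleMinPrinciple`); MIX: `∫ θ(T − r²/2)² ≤ δ² ∫ φ² ≤ δ² r³ |B₁|`.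
2. Mass `m = ∫ φ ≥ |B₁| r³/8` is conserved: `∫ θ(t) = m` (`massExport_mass_conserved`, tools
   file: differentiation under the integral, whole-space integrations by parts, `div u = 0`).
3. With the scaled cutoff `ψ` of `B̄(x₀, R)` (`mexaux_existsCutoff`: `‖Dψ‖ ≤ C₁/R`,
   `|Δψ| ≤ C₂/R²`, `Dψ = 0` off `B(x₀, 2R)`): `∫ θ(T − r²) ψ = m` (`R ≥ r`), while
   `∫ θ(T − r²/2) ψ ≤ ∫_{B(x₀, 2R)} θ ≤ 3m/8` (`massExport_integral_mul_cutoff_le`, weighted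
   AM–GM against the `L²` bound: this is where `R ∼ r δ^{-2/3}` comes from).
4. By the Lagrange form of the weighted-mass evolution (`massExport_weightedMass_sub_eq`) the
   drop, which is at least `5m/8`, equals `−(r²/2) ∫ θ(ξ)(Δψ + Dψ[u(ξ)])` for some `ξ` in the
   window, and this is at most `(r²/2) m (C₂/R² + (C₁/R) c s/r) = m (256 C₂/s² + 1/4)/2 ≤ 3m/8`
   once `s ≥ max(16, 32 C₂)`, i.e. `δ ≤ δ₀ = max(16, 32 C₂)^{-2}` — a contradiction
   (`massExport_bookkeeping`; `c = 1/(64 C₁)`).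

Everything is proved (standard axioms); no definitions, no named facts.
-/

noncomputable section

open Literature.Analysis.FluidPDE MeasureTheory Set Function Metric Filter Topology
open scoped ContDiff InnerProductSpace Laplacian

-- `Summit = Problem` for this summit; the tree lakefile sets `weak.linter.dupNamespace = false`,
-- made explicit here for out-of-tree `lean check`.
set_option linter.dupNamespace false

namespace Summit.NavierStokesRegularity.NavierStokesRegularity.Theorems

local notation "E3" => EuclideanSpace ℝ (Fin 3)

/-! ### Real-variable bookkeeping -/

/-- Algebra of the scale factor: `s = δ^{-2/3}` satisfies `δ² s³ = 1`. -/
theorem massExport_sq_mul_rpow_cube {δ : ℝ} (hδ : 0 < δ) :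
    δ ^ 2 * (δ ^ (-(2:ℝ) / 3)) ^ 3 = 1 := by
  have e : (δ ^ (-(2:ℝ) / 3)) ^ 3 = (δ ^ 2)⁻¹ := by
    rw [← Real.rpow_natCast, ← Real.rpow_mul hδ.le,
      show (-(2:ℝ) / 3 * ((3:ℕ) : ℝ)) = -2 by norm_num, Real.rpow_neg hδ.le, Real.rpow_two]
  rw [e, mul_inv_cancel₀ (pow_ne_zero 2 hδ.ne')]

/-- Smallness of `δ` makes the scale factor large: `1 ≤ A`, `δ ≤ 1/A²`, `δ² s³ = 1` give
`A ≤ s`. -/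
theorem massExport_le_of_sq_mul_cube {A s δ : ℝ} (hA1 : 1 ≤ A) (hδ : 0 < δ)
    (hδA : δ ≤ 1 / A ^ 2) (hs0 : 0 < s) (hs3 : δ ^ 2 * s ^ 3 = 1) : A ≤ s := by
  have hApos : 0 < A := by linarith
  refine le_of_pow_le_pow_left₀ three_ne_zero hs0.le ?_
  have h1 : A ^ 4 * δ ^ 2 ≤ 1 := by
    calc A ^ 4 * δ ^ 2 ≤ A ^ 4 * (1 / A ^ 2) ^ 2 := by gcongr
      _ = 1 := by field_simp
  have h2 : A ^ 3 ≤ A ^ 4 := pow_le_pow_right₀ hA1 (by norm_num)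
  have h3 : A ^ 4 ≤ s ^ 3 := by
    refine le_of_mul_le_mul_right ?_ (by positivity : (0:ℝ) < δ ^ 2)
    calc A ^ 4 * δ ^ 2 ≤ 1 := h1
      _ = s ^ 3 * δ ^ 2 := by rw [mul_comm]; exact hs3.symm
  exact h2.trans h3

/-- **The final bookkeeping of the mass-export argument** (pure real arithmetic). With
`s ≥ 16`, `s ≥ 32 C₂`, `δ² s³ = 1`, `R = r s/16`, `U₀ = s/(64 C₁ r)`, `K = C₂/R² + (C₁/R) U₀`,
mass `m ≥ |B₁| r³/8`, weighted masses `Ma = m`,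
`Mb ≤ ((s³/16) δ² r³ |B₁| + (16/s³) (2R)³ |B₁|)/2 = 3 |B₁| r³ / 64 ≤ 3m/8`, the Lagrange identity
`Mb − Ma = (r²/2) G` and the production bound `G ≥ −K m` are contradictory:
`5m/8 ≤ Ma − Mb ≤ (r²/2) K m = (256 C₂/s² + 1/4) m / 2 ≤ 3m/8`. -/
theorem massExport_bookkeeping {C₁ C₂ s r R U₀ K m V Ma Mb G δ : ℝ} (hr : 0 < r)
    (hs0 : 0 < s) (hs16 : 16 ≤ s) (hsC₂ : 32 * C₂ ≤ s) (hC₁ : 0 < C₁)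
    (hs3 : δ ^ 2 * s ^ 3 = 1) (hR : R = r * s / 16) (hU₀ : U₀ = 1 / (64 * C₁) * s / r)
    (hK : K = C₂ / R ^ 2 + C₁ / R * U₀) (hV : 0 < V) (hm : V * r ^ 3 / 8 ≤ m) (hMa : Ma = m)
    (hMb : Mb ≤ (s ^ 3 / 16 * (δ ^ 2 * (r ^ 3 * V)) + 16 / s ^ 3 * ((2 * R) ^ 3 * V)) / 2)
    (hLag : Mb - Ma = r ^ 2 / 2 * G) (hG : -(K * m) ≤ G) : False := by
  have hm0 : 0 < m := lt_of_lt_of_le (by positivity) hm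
  -- the far mass at the final time is at most `3m/8`
  have h1 : s ^ 3 / 16 * (δ ^ 2 * (r ^ 3 * V)) = r ^ 3 * V / 16 := by
    linear_combination (r ^ 3 * V / 16) * hs3
  have h2 : 16 / s ^ 3 * ((2 * R) ^ 3 * V) = r ^ 3 * V / 32 := by
    rw [hR]
    field_simp
    ring
  have hMb' : Mb ≤ 3 * m / 8 := by
    rw [h1, h2] at hMb
    linarith
  -- hence the weighted mass drops by at least `5m/8`, but the drop is at most `(r²/2) K m`
  have h5 : 5 * m / 8 ≤ r ^ 2 / 2 * (K * m) := by
    have h := mul_le_mul_of_nonneg_left hG (by positivity : (0:ℝ) ≤ r ^ 2 / 2)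
    linarith
  have h6 : 5 / 8 ≤ r ^ 2 / 2 * K := by
    by_contra h
    have h' : r ^ 2 / 2 * K < 5 / 8 := not_le.1 h
    nlinarith
  have hkey : r ^ 2 / 2 * K = (256 * C₂ / s ^ 2 + 1 / 4) / 2 := by
    rw [hK, hR, hU₀]
    field_simp
    ring
  have hsmall : 256 * C₂ / s ^ 2 ≤ 1 / 2 := by
    rw [div_le_iff₀ (by positivity)]
    nlinarith
  linarith

/-! ### Two integral estimates -/

/-- The mass of a bump is at least the volume of its plateau: `|B̄(x₀, r_in)| ≤ ∫ φ`. -/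
theorem massExport_measureReal_closedBall_le_integral {x₀ : E3} (φ : ContDiffBump x₀) :
    (volume : Measure E3).real (closedBall x₀ φ.rIn) ≤ ∫ x, φ x := by
  have hind : ∀ x, (closedBall x₀ φ.rIn).indicator (fun _ => (1 : ℝ)) x ≤ φ x := fun x => by
    by_cases hx : x ∈ closedBall x₀ φ.rIn
    · rw [indicator_of_mem hx, φ.one_of_mem_closedBall hx]
    · rw [indicator_of_notMem hx]; exact φ.nonneg
  calc (volume : Measure E3).real (closedBall x₀ φ.rIn)
      = ∫ x, (closedBall x₀ φ.rIn).indicator (fun _ => (1 : ℝ)) x := by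
        rw [integral_indicator_const _ measurableSet_closedBall, smul_eq_mul, mul_one]
    _ ≤ ∫ x, φ x := integral_mono_of_nonneg
        (ae_of_all _ fun x => indicator_nonneg (fun _ _ => zero_le_one) x)
        (φ.continuous.integrable_of_hasCompactSupport φ.hasCompactSupport) (ae_of_all _ hind)

/-- **Far mass is small under an `L²` bound** (weighted AM–GM). For `θ₁ ≥ 0` with `θ₁²`
integrable and `∫ θ₁² ≤ P`, a weight `0 ≤ ψ ≤ 1` vanishing where `dist(x, x₀) ≥ ρ` (`ρ > 0`),
and `λ > 0`, `μ` with `λ μ = 1`: `∫ θ₁ ψ ≤ (λ P + μ ρ³ |B₁|) / 2`, from the pointwise inequality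
`θ₁ ψ ≤ (λ θ₁² + μ 1_{B(x₀, ρ)}) / 2`. -/
theorem massExport_integral_mul_cutoff_le {θ₁ ψ : E3 → ℝ} {x₀ : E3} {ρ P lam mu : ℝ}
    (hθ0 : ∀ x, 0 ≤ θ₁ x) (hsq : Integrable (fun x => θ₁ x ^ 2) (volume : Measure E3))
    (hP : ∫ x, θ₁ x ^ 2 ≤ P) (hψ0 : ∀ x, 0 ≤ ψ x) (hψ1 : ∀ x, ψ x ≤ 1)
    (hψzero : ∀ x, ρ ≤ dist x x₀ → ψ x = 0) (hρ : 0 < ρ) (hlam : 0 < lam)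
    (hlm : lam * mu = 1) :
    ∫ x, θ₁ x * ψ x ≤ (lam * P + mu * (ρ ^ 3 * (volume : Measure E3).real (ball (0 : E3) 1))) / 2 := by
  set B : Set E3 := ball x₀ ρ with hB_def
  have hpt : ∀ x, θ₁ x * ψ x ≤ (lam * θ₁ x ^ 2 + mu * B.indicator (fun _ => (1 : ℝ)) x) / 2 := by
    intro x
    have hθx := hθ0 x
    by_cases hx : x ∈ B
    · rw [indicator_of_mem hx, mul_one]
      have key : 2 * θ₁ x ≤ lam * θ₁ x ^ 2 + mu := by
        nlinarith [sq_nonneg (lam * θ₁ x - 1)]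
      nlinarith [hψ1 x, hψ0 x]
    · rw [indicator_of_notMem hx, mul_zero, add_zero]
      have hx' : ρ ≤ dist x x₀ := by rwa [hB_def, mem_ball, not_lt] at hx
      rw [hψzero x hx', mul_zero]
      positivity
  have hIind : Integrable (B.indicator fun _ => (1 : ℝ)) (volume : Measure E3) :=
    (integrableOn_const (measure_ball_lt_top (x := x₀) (r := ρ)).ne).integrable_indicator
      measurableSet_ball
  have hvolB : (volume : Measure E3).real B = ρ ^ 3 * (volume : Measure E3).real (ball (0 : E3) 1) := by
    rw [hB_def, ← Measure.addHaar_real_closedBall_eq_addHaar_real_ball,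
      Measure.addHaar_real_closedBall _ _ hρ.le, finrank_euclideanSpace_fin]
  calc ∫ x, θ₁ x * ψ x
      ≤ ∫ x, (lam * θ₁ x ^ 2 + mu * B.indicator (fun _ => (1 : ℝ)) x) / 2 :=
        integral_mono_of_nonneg (ae_of_all _ fun x => mul_nonneg (hθ0 x) (hψ0 x))
          (((hsq.const_mul lam).add (hIind.const_mul mu)).div_const 2) (ae_of_all _ hpt)
    _ = (lam * (∫ x, θ₁ x ^ 2) + mu * (ρ ^ 3 * (volume : Measure E3).real (ball (0 : E3) 1))) / 2 := by
        rw [integral_div, integral_add (hsq.const_mul lam) (hIind.const_mul mu),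
          integral_const_mul, integral_const_mul, integral_indicator_const _ measurableSet_ball,
          smul_eq_mul, mul_one, hvolB]
    _ ≤ (lam * P + mu * (ρ ^ 3 * (volume : Measure E3).real (ball (0 : E3) 1))) / 2 := by
        gcongr

/-! ### The theorem -/

/-- **Mass export: `δ`-mixing at scale `r` forces velocity `≳ δ^{-2/3}/r` on the window.**
There are absolute constants `δ₀, c > 0` such that for every standing solution (`0 < T`,
`(u, p)` classical on `[0, T) × ℝ³` with `ν = 1`, `f = 0`, Leray–Hopf from `u 0`, rapidly
decaying datum), every `x₀`, `0 < r` with `r² < T` and `0 < δ ≤ δ₀`: if `u` dissipates at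
scale `r` with factor `δ` at `(T, x₀)` (`DissipatesAtScale`, the route's MIX), then somewhere
on `[T − r², T − r²/2] × B̄(x₀, r δ^{-2/3})` the speed is at least `c δ^{-2/3} / r`.

Proof ("mass export"). Put `s = δ^{-2/3}`, `R = r s / 16` (`≥ r` for `δ ≤ δ₀`) and suppose
`‖u‖ < c s / r` on the window over `B̄(x₀, r s) ⊇ B(x₀, 2R)`. Launch the MIX-admissible
scalar `θ` from the bump `φ` (`= 1` on `B̄(x₀, r/2)`, supported in `B(x₀, r)`) through
`stub_windowRegularity` + `stub_advectionDiffusionSchwartz`; `θ ≥ 0`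
(`stub_admissibleMinPrinciple`), its mass `m = ∫ θ(t) = ∫ φ ≥ |B̄_{r/2}|` is conserved
(`massExport_mass_conserved`), and MIX gives `∫ θ(T − r²/2)² ≤ δ² ∫ φ² ≤ δ² r³ |B₁|`. With the
scaled cutoff `ψ` of `B̄(x₀, R)` (`mexaux_existsCutoff`): at `t = T − r²`, `∫ θ ψ = m`;
at `t = T − r²/2`, `∫ θ ψ ≤ 3m/8` (`massExport_integral_mul_cutoff_le`); by
`massExport_weightedMass_sub_eq` the drop `Ma − Mb` equals `−(r²/2) ∫ θ(ξ)(Δψ + Dψ[u(ξ)])`,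
which is at most `(r²/2) m (C₂/R² + (C₁/R) c s/r)` since `θ ≥ 0`, `∫ θ(ξ) = m`, `|Δψ| ≤ C₂/R²`,
`‖Dψ‖ ≤ C₁/R` and `Dψ = 0` off `B(x₀, 2R)`; `massExport_bookkeeping` closes. -/
theorem mixingPayoff_massExport :
    ∃ δ₀ : ℝ, 0 < δ₀ ∧ ∃ c : ℝ, 0 < c ∧
    ∀ (T : ℝ) (u : ℝ → E3 → E3) (p : ℝ → E3 → ℝ), 0 < T →
    IsClassicalNSSolutionOn (Set.Ico 0 T) 1 0 u p → IsLerayHopfOn T 1 0 (u 0) u →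
    HasRapidSpatialDecay (u 0) →
    ∀ (x₀ : E3) (r δ : ℝ), 0 < r → r ^ 2 < T → 0 < δ → δ ≤ δ₀ →
    DissipatesAtScale u T x₀ r δ →
    ∃ t ∈ Set.Icc (T - r ^ 2) (T - r ^ 2 / 2), ∃ x ∈ Metric.closedBall x₀ (r * δ ^ (-(2:ℝ) / 3)),
      c * δ ^ (-(2:ℝ) / 3) / r ≤ ‖u t x‖ := by
  obtain ⟨C₁, C₂, hC₁, -, hcut⟩ := mexaux_existsCutoff
  obtain ⟨A, hA_def⟩ : ∃ A : ℝ, A = max 16 (32 * C₂) := ⟨_, rfl⟩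
  have hA16 : 16 ≤ A := hA_def ▸ le_max_left _ _
  have hAC₂ : 32 * C₂ ≤ A := hA_def ▸ le_max_right _ _
  have hA1 : 1 ≤ A := by linarith
  have hA0 : 0 < A := by linarith
  refine ⟨1 / A ^ 2, by positivity, 1 / (64 * C₁), by positivity, ?_⟩
  intro T u p hT hcl hLH hdec x₀ r δ hr hrT hδ hδA hMIX
  -- ### the scale factor `s = δ^{-2/3}` and the radius `R = r s / 16`
  obtain ⟨s, hs_def⟩ : ∃ s : ℝ, s = δ ^ (-(2:ℝ) / 3) := ⟨_, rfl⟩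
  rw [← hs_def]
  have hs0 : 0 < s := hs_def ▸ Real.rpow_pos_of_pos hδ _
  have hs3 : δ ^ 2 * s ^ 3 = 1 := hs_def ▸ massExport_sq_mul_rpow_cube hδ
  have hsA : A ≤ s := massExport_le_of_sq_mul_cube hA1 hδ hδA hs0 hs3
  have hs16 : 16 ≤ s := hA16.trans hsA
  have hsC₂ : 32 * C₂ ≤ s := hAC₂.trans hsA
  obtain ⟨R, hR_def⟩ : ∃ R : ℝ, R = r * s / 16 := ⟨_, rfl⟩
  have hR : 0 < R := by rw [hR_def]; positivity
  have hRr : r ≤ R := by rw [hR_def]; nlinarith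
  have h2R : 2 * R ≤ r * s := by rw [hR_def]; nlinarith
  by_contra hcon
  push Not at hcon
  obtain ⟨U₀, hU₀_def⟩ : ∃ U₀ : ℝ, U₀ = 1 / (64 * C₁) * s / r := ⟨_, rfl⟩
  rw [← hU₀_def] at hcon
  have hU₀ : 0 < U₀ := by rw [hU₀_def]; positivity
  -- ### the window
  have hr2 : 0 < r ^ 2 := pow_pos hr 2
  have hab : T - r ^ 2 < T - r ^ 2 / 2 := by linarith
  have ha0 : 0 ≤ T - r ^ 2 := by linarith
  have hbT : T - r ^ 2 / 2 < T := by linarith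
  have hSsub : Icc (T - r ^ 2) (T - r ^ 2 / 2) ⊆ Ico 0 T := fun t ht =>
    ⟨ha0.trans ht.1, ht.2.trans_lt hbT⟩
  have hbS : T - r ^ 2 / 2 ∈ Icc (T - r ^ 2) (T - r ^ 2 / 2) := ⟨hab.le, le_rfl⟩
  -- ### the drift on the window: smooth, bounded, divergence free
  obtain ⟨hsmU, hbdU⟩ := stub_windowRegularity T u p hT hcl hLH hdec (T - r ^ 2) (T - r ^ 2 / 2)
    ha0 hab hbT
  obtain ⟨Mu, hMu⟩ := hbdU 0
  have hub : ∀ t ∈ Icc (T - r ^ 2) (T - r ^ 2 / 2), ∀ x : E3, ‖u t x‖ ≤ Mu := fun t ht x => by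
    have := hMu t ht x
    rwa [norm_iteratedFDerivWithin_zero, Function.uncurry_apply_pair] at this
  have hu1 : ∀ t ∈ Icc (T - r ^ 2) (T - r ^ 2 / 2), ContDiff ℝ 1 (u t) := fun t ht =>
    contDiff_infty.1 (hcl.contDiff_velocity (hSsub ht)) 1
  have hdiv : ∀ t ∈ Icc (T - r ^ 2) (T - r ^ 2 / 2), VectorCalculus.IsDivFree (u t) :=
    fun t ht => hcl.divFree t (hSsub ht)
  -- ### the scalar launched from the bump datum
  let φ : ContDiffBump x₀ := ⟨r / 2, r, by positivity, by linarith⟩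
  obtain ⟨θ, hθs, hθd, hθpde, hθa⟩ := stub_advectionDiffusionSchwartz (T - r ^ 2) (T - r ^ 2 / 2)
    hab u hsmU hbdU φ φ.contDiff φ.hasCompactSupport
  have hθpos : ∀ t ∈ Icc (T - r ^ 2) (T - r ^ 2 / 2), ∀ x : E3, 0 ≤ θ t x :=
    stub_admissibleMinPrinciple T r u θ hr hθs hθd hθpde fun x => by rw [hθa]; exact φ.nonneg
  -- MIX: `∫ θ(T - r²/2)² ≤ δ² ∫ φ² ≤ δ² r³ |B₁|`
  obtain ⟨V, hV_def⟩ : ∃ V : ℝ, V = (volume : Measure E3).real (ball (0 : E3) 1) := ⟨_, rfl⟩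
  have hV : 0 < V := by
    rw [hV_def, measureReal_def]
    exact ENNReal.toReal_pos (measure_ball_pos _ _ one_pos).ne' measure_ball_lt_top.ne
  have hmix : ∫ x, (θ (T - r ^ 2 / 2) x) ^ 2 ≤ δ ^ 2 * (r ^ 3 * V) := by
    have h1 := hMIX θ hθs hθd hθpde (by rw [hθa]; exact φ.support_eq.le)
    have h2 : ∫ x, (θ (T - r ^ 2) x) ^ 2 ≤ r ^ 3 * V := by
      rw [hθa, hV_def]
      exact typeIFloor_integral_sq_le_of_bump hr.le (fun x => φ.nonneg) (fun x => φ.le_one)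
        φ.support_eq.le
    exact h1.trans (mul_le_mul_of_nonneg_left h2 (sq_nonneg _))
  -- ### mass and its conservation
  obtain ⟨m, hm_def⟩ : ∃ m : ℝ, m = ∫ x, φ x := ⟨_, rfl⟩
  have hm : V * r ^ 3 / 8 ≤ m := by
    have h := massExport_measureReal_closedBall_le_integral φ
    rw [Measure.addHaar_real_closedBall _ _ (by positivity : (0:ℝ) ≤ r / 2),
      finrank_euclideanSpace_fin, ← hV_def, ← hm_def] at h
    have e : V * r ^ 3 / 8 = (r / 2) ^ 3 * V := by ring
    rw [e]
    exact h
  have hmass : ∀ t ∈ Icc (T - r ^ 2) (T - r ^ 2 / 2), ∫ x, θ t x = m := fun t ht => by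
    rw [massExport_mass_conserved hab hθs hθd hθpde hu1 hdiv hub t ht, hθa, hm_def]
  -- ### the cutoff at scale `R` and the weighted mass `∫ θ ψ`
  obtain ⟨ψ, hψs, hψ0, hψ1, hψone, hψzero, hDψzero, hDψ, hΔψ, Mψ, hMψ⟩ := hcut x₀ R hR
  obtain ⟨-, hIθ, hIG, -⟩ := massExport_weightedMass hab hθs hθd hθpde hu1 hdiv hub hψs
    (fun x => (hMψ x).1) (fun x => (hMψ x).2.1) (fun x => (hMψ x).2.2)
  obtain ⟨ξ, hξ, hLag⟩ := massExport_weightedMass_sub_eq hab hθs hθd hθpde hu1 hdiv hub hψs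
    (fun x => (hMψ x).1) (fun x => (hMψ x).2.1) (fun x => (hMψ x).2.2) ⟨hab, le_rfl⟩
  have hξS : ξ ∈ Icc (T - r ^ 2) (T - r ^ 2 / 2) := ⟨hξ.1.le, hξ.2.le⟩
  -- at `t = T - r²`: `∫ θ ψ = ∫ φ = m` (`ψ = 1` on `supp φ ⊆ B(x₀, r) ⊆ B̄(x₀, R)`)
  have hMa : ∫ x, θ (T - r ^ 2) x * ψ x = m := by
    rw [hθa, hm_def]
    refine integral_congr_ae (ae_of_all _ fun x => ?_)
    show φ x * ψ x = φ x
    by_cases hx : φ x = 0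
    · rw [hx, zero_mul]
    · have hxb : x ∈ ball x₀ r := by
        have : x ∈ Function.support φ := hx
        rw [φ.support_eq] at this
        exact this
      rw [hψone x ((mem_ball.1 hxb).le.trans hRr), mul_one]
  -- at `t = T - r²/2`: weighted AM–GM with `λ = s³/16`
  have hMb := massExport_integral_mul_cutoff_le (lam := s ^ 3 / 16) (mu := 16 / s ^ 3)
    (hθpos _ hbS) (typeIFloor_integrable_sq_slice hθs hθd hbS) hmix hψ0 hψ1 hψzero
    (by positivity) (by positivity) (by field_simp)
  rw [← hV_def] at hMb
  -- ### the production term is bounded below by `-K m`, `K = C₂/R² + (C₁/R) U₀`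
  obtain ⟨K, hK_def⟩ : ∃ K : ℝ, K = C₂ / R ^ 2 + C₁ / R * U₀ := ⟨_, rfl⟩
  obtain ⟨G, hG_def⟩ : ∃ G : ℝ, G = ∫ x, θ ξ x * ((Δ ψ) x + fderiv ℝ ψ x (u ξ x)) := ⟨_, rfl⟩
  rw [← hG_def] at hLag
  have hG : -(K * m) ≤ G := by
    have hpt : ∀ x, -K * θ ξ x ≤ θ ξ x * ((Δ ψ) x + fderiv ℝ ψ x (u ξ x)) := by
      intro x
      have hθx := hθpos ξ hξS x
      have hΔ : -(C₂ / R ^ 2) ≤ (Δ ψ) x := (abs_le.1 (hΔψ x)).1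
      have hD : -(C₁ / R * U₀) ≤ fderiv ℝ ψ x (u ξ x) := by
        by_cases hx : 2 * R ≤ dist x x₀
        · rw [hDψzero x hx, zero_apply, neg_nonpos]
          exact (mul_pos (div_pos hC₁ hR) hU₀).le
        · have hx' : dist x x₀ < 2 * R := not_le.1 hx
          have hxball : x ∈ closedBall x₀ (r * s) :=
            mem_closedBall.2 (by linarith only [hx', h2R])
          have hux : ‖u ξ x‖ ≤ U₀ := (hcon ξ hξS x hxball).le
          have h := (ContinuousLinearMap.le_opNorm (fderiv ℝ ψ x) (u ξ x)).trans
            (mul_le_mul (hDψ x) hux (norm_nonneg _) (div_pos hC₁ hR).le)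
          rw [Real.norm_eq_abs] at h
          exact (abs_le.1 h).1
      have hsum := add_le_add hΔ hD
      rw [← neg_add, ← hK_def] at hsum
      have h := mul_le_mul_of_nonneg_left hsum hθx
      rw [mul_comm] at h
      exact h
    have h := integral_mono ((hIθ ξ hξS).const_mul _) (hIG ξ hξS) hpt
    rw [integral_const_mul, hmass ξ hξS, ← hG_def] at h
    linarith only [h]
  -- ### bookkeeping
  have hba : T - r ^ 2 / 2 - (T - r ^ 2) = r ^ 2 / 2 := by ring
  rw [hba] at hLag
  exact massExport_bookkeeping hr hs0 hs16 hsC₂ hC₁ hs3 hR_def hU₀_def hK_def hV hm hMa hMb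
    hLag hG

end Summit.NavierStokesRegularity.NavierStokesRegularity.Theorems

end
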